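import Literature.MathematicalPhysics.QuantumFieldTheory.BalabanImbrieJaffe1984to88.BIJ88Resummation5141Adm
import Literature.MathematicalPhysics.QuantumFieldTheory.BalabanImbrieJaffe1984to88.BIJ88PolymerRep5134Gauss
import Literature.MathematicalPhysics.QuantumFieldTheory.BalabanImbrieJaffe1984to88.BIJ88Extraction311

/-!
# `BalabanImbrieJaffe1984to88.BIJ88Eq5145Corner` — T. Bałaban, J. Imbrie, A. Jaffe, *Effective action and cluster properties of the abelian
Higgs model*, Commun. Math. Phys. **114** (1988) 257–315 [BalabanImbrieJaffe1988]: Sect. 5.14, p. 312 [PDF 56], **(5.14.5) ASSEMBLED IN THE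
ADMISSIBLE (CORNER-DATA) BOOKKEEPING OF (5.13.4)/(5.14.1)** (rows `C2.Eq5.14.5`, `C2.Eq5.14.1-5.14.2`): gen 7's `BIJ88Result5145.eq5145` took
(5.14.1) through the displayed hypothesis `hdec` stated over ALL set partitions — the form the cube-wise decoupling expansion does NOT deliver
(GAPS G-C2-p25-03; gen 8's `BIJ88Resummation5141Adm`: admissible fillings only, inner factor `z(Λ₁₂)(Λ₁₂′)`). Here (5.14.5) is re-assembled on
gen 8's HONEST resummation `polymerRep_resummed` for ANY cluster-factorizing corner data — so the (5.14.1) input is BY NAME, no `hdec` — and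
INSTANTIATED on the Gaussian measures of §5.13 (`BIJ88PolymerRep5134Gauss.zG`, cluster-factorizing by `isClusterFactorizing_zG`), with p31 g12's
p. 311 extraction (`BIJ88Extraction311.extraction311`) feeding `h311` by name.

HONEST FRAMING (cell `lit-balaban`, verbatim): statement-level skeleton of published theorems with citation tags; proofs where landed; nothing here is a claim about the Yang–Mills mass gap.

PDF held: `paper:balaban1988-cmp114-bij-abelian-higgs-effective-action` (journal page = PDF page + 256); p. 312 = PDF 56, read this session.

**(5.14.5)** p. 312 [PDF 56], verbatim: *"To summarize the results of this section, we have e^{−V^{(k)}_{const}(Λ₈^{(k)})} Σ_{{X_α}} Π_α g₂(X_α) =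
Σ_{{X_α} overlapping Λ₁₁^{(k)c}} Π_α g₂(X_α) Σ_{{X_{r′}}} Π_{r′} G_k(X_{r′}) × Π_{c: X_c⊄∪_{r′}X_{r′}} F^L_{k+1,loc}(X_c) exp(−𝒫^L_{k+1,loc}(Λ₈^{(k)}) − Σ_X
W₆^{(k)}(X)). (5.14.5)"* — with (5.14.1) p. 308 *"Σ_{{X_α}} Π_α g₂(X_α) = Σ_{{X_α} overlapping Λ₁₁^{(k)c}} Π_α g₂(X_α) z_F(Λ₁₂^{(k)})"*, *"z_F =
(z_F/z) exp(log z)"*, (5.14.2), p. 310 *"ℛ_k(Λ₁₂^{(k)}) = Σ_X W₆^{(k)′}(X)"*, p. 311 *"V^{(k)}_{const} + 𝒫̃_{k+1} = 𝒫^L_{k+1,loc} + Σ_X W₆^{(k)″}(X)"*,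
*"W₆ = W₆′ + W₆″"*, p. 312 *"z_F/z = ⟨Π F^{m̄}_{k,loc}(X_{σ₁})⟩₁ = …"*.

**What is proved (0 `sorry`, standard axioms, 0 new `Prop` facts, theorems only).** Cubes `ι`, abutting `adj`, large-field cubes `B ⊆ W`,
outer families `ρ ∈ outer W B` (gen 7), admissible ones (gen 8), `Λ₁₂ = lam12 W ρ`, decoupled layer `Λ₁₂′ = lam12′ adj W ρ`; the left side of
(5.14.5) is `e^{−V_const}·z W W` = `e^{−V_const}·Σ_{{X_α} admissible} Π g₁(X_α)` ((5.13.4), gen 8 `polymerRep`); per admissible outer family `ρ`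
(i.e. per region `Λ₁₂`) the displayed inputs: `hz` the observable-free normalization `z₀ ρ > 0`; `hratio` *"z_F = (z_F/z)·z"*:
`z(Λ₁₂)(Λ₁₂′) = ratio ρ · z₀ ρ` (`ratio ρ` = ⟨Π F⟩₁, whose printed structure is `BIJ88IbpResult312`/`BIJ88Eq5145Structural`); `hlogz` (5.14.2)
`log z₀ ρ = −pert ρ − rem ρ`; `hrem` p. 310; `h311` p. 311.
* **`eq5145_corner`** — for every cluster-factorizing corner family `z`: `e^{−V_const}·z W W = Σ_{ρ admissible outer} (Π_{X∈ρ} g₁ X) · ratio ρ ·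
  exp(−𝒫^L − Σ_X (W₆′ + W₆″))` — (5.14.5) with (5.13.4)∘(5.14.1) BY NAME (`polymerRep_resummed`), no `hdec`.
* **`eq5145_corner_gauss`** — the same ON THE GAUSSIAN MEASURES OF §5.13 (`z := zG blk Δ ℱ f`, `Δ` coupling abutting cubes only, cube-local
  factors): left side `e^{−V_const}·⟨Π_{i∈W} f(□_i)⟩_{1,W}`.
* **`eq5145_corner_extraction`** — `eq5145_corner` with `h311` FED BY NAME from p31's `extraction311` (`𝒫^L := PL`, `W₆″ := W6pp`, `𝒳 := A.powerset`,
  region-dependent propagator pieces); **`eq5145_corner_gauss_extraction`** — both at once.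
HONEST SCOPE: `hratio`/`hlogz`/`hrem` stay displayed per region (their by-name discharge needs the t-family of (5.14.2) on the SAME model through
`t = 0`: p36's lineage has the branch `t ∈ (0,1]` modulo the leaf (5.14.4) — `BIJ88SlotConnectedGraph310KP` — and records the `t = 0` end as open);
Mayer data fixed (gen 8 reading: `g₂ ↔ g₁`); the located imprecision of (5.14.1) (inner factor `z(Λ₁₂)(Λ₁₂′)`, not the fully coupled `z(Λ₁₂)(Λ₁₂)`)
is carried verbatim. Imports `BIJ88Resummation5141Adm`, `BIJ88PolymerRep5134Gauss` (p25 g8), `BIJ88Extraction311` (p31 g12); modifies nothing. NOT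
summit progress; NOT continuum; NOT Clay. Cell `lit-balaban` Phase 2, seat p25 gen 13 (row owner r16, referee ref-5).
-/

noncomputable section

open Finset
open Literature.Probability.LatticeModels (setPartitions)
open Literature.MathematicalPhysics.QuantumFieldTheory.BalabanImbrieJaffe1984to88.BIJ88Clusters5134 (IsClusterFactorizing)
open Literature.MathematicalPhysics.QuantumFieldTheory.BalabanImbrieJaffe1984to88.BIJ88PolymerRep5134 (g1 IsAdmissible polymerRep corner)
open Literature.MathematicalPhysics.QuantumFieldTheory.BalabanImbrieJaffe1984to88.BIJ88Resummation5141 (outer lam12 lam12_subset mem_outer)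
open Literature.MathematicalPhysics.QuantumFieldTheory.BalabanImbrieJaffe1984to88.BIJ88Resummation5141Adm (lam12' polymerRep_resummed)
open Literature.MathematicalPhysics.QuantumFieldTheory.BalabanImbrieJaffe1984to88.BIJ88PolymerRep5134Gauss (expect zG isClusterFactorizing_zG)
open Literature.MathematicalPhysics.QuantumFieldTheory.BalabanImbrieJaffe1984to88.BIJ88Extraction311 (pert PL W6pp extraction311)

namespace Literature.MathematicalPhysics.QuantumFieldTheory.BalabanImbrieJaffe1984to88.BIJ88Eq5145Corner

/-! ## §1 (5.14.5) on cluster-factorizing corner data -/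

section Corner

variable {ι : Type*} [DecidableEq ι] (adj : ι → ι → Prop) [DecidableRel adj]

/-- **(5.14.5) IN THE ADMISSIBLE BOOKKEEPING** — for every cluster-factorizing corner family `z` (`z X Λ = ⟨Π_{□_i⊂X} f(□_i)⟩_{1_Λ,X}`), with
(5.13.4)∘(5.14.1) by name (gen 8 `polymerRep_resummed`): per admissible outer family `ρ` (`Λ₁₂ = lam12 W ρ`, `Λ₁₂′ = lam12′ adj W ρ`) the displayed
inputs `hz` (normalization `z₀ ρ > 0`), `hratio` (*"z_F = (z_F/z) exp(log z)"*: `z(Λ₁₂)(Λ₁₂′) = ratio ρ · z₀ ρ`), `hlogz` ((5.14.2) split),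
`hrem` (p. 310 `ℛ_k = Σ_X W₆′(X)`), `h311` (p. 311); then
`e^{−V_const}·z W W = Σ_{ρ} (Π_{X∈ρ} g₁ X) · ratio ρ · exp(−𝒫^L − Σ_{X∈𝒳}(W₆′(X) + W₆″(X)))`. [cite: BalabanImbrieJaffe1988, (5.14.5) p.312] -/
theorem eq5145_corner {z : Finset ι → Finset ι → ℝ} (hzc : IsClusterFactorizing adj z) (W B : Finset ι) {Xt : Type*} (𝒳 : Finset Xt)
    (Vconst PL : ℝ) (z₀ ratio pert rem : Finset (Finset ι) → ℝ) (W6p W6pp : Finset (Finset ι) → Xt → ℝ)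
    (hz : ∀ ρ ∈ (outer W B).filter (IsAdmissible adj), 0 < z₀ ρ)
    (hratio : ∀ ρ ∈ (outer W B).filter (IsAdmissible adj), z (lam12 W ρ) (lam12' adj W ρ) = ratio ρ * z₀ ρ)
    (hlogz : ∀ ρ ∈ (outer W B).filter (IsAdmissible adj), Real.log (z₀ ρ) = -pert ρ - rem ρ)
    (hrem : ∀ ρ ∈ (outer W B).filter (IsAdmissible adj), rem ρ = ∑ X ∈ 𝒳, W6p ρ X)
    (h311 : ∀ ρ ∈ (outer W B).filter (IsAdmissible adj), Vconst + pert ρ = PL + ∑ X ∈ 𝒳, W6pp ρ X) :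
    Real.exp (-Vconst) * z W W =
      ∑ ρ ∈ (outer W B).filter (IsAdmissible adj),
        (∏ X ∈ ρ, g1 adj z X) * (ratio ρ * Real.exp (-PL - ∑ X ∈ 𝒳, (W6p ρ X + W6pp ρ X))) := by
  rw [polymerRep_resummed (adj := adj) hzc W B, mul_sum]
  refine sum_congr rfl fun ρ hρ => ?_
  have hz' := hz ρ hρ
  -- `e^{−V_const} · z(Λ₁₂)(Λ₁₂′) = ratio · e^{log z₀ − V_const} = ratio · e^{−𝒫^L − Σ W₆″ − Σ W₆′}`
  have hexp : Real.exp (-Vconst) * z₀ ρ = Real.exp (-PL - ∑ X ∈ 𝒳, (W6p ρ X + W6pp ρ X)) := by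
    rw [← Real.exp_log hz', ← Real.exp_add, hlogz ρ hρ, hrem ρ hρ]
    congr 1
    rw [sum_add_distrib]
    linarith [h311 ρ hρ]
  calc Real.exp (-Vconst) * ((∏ X ∈ ρ, g1 adj z X) * z (lam12 W ρ) (lam12' adj W ρ))
      = (∏ X ∈ ρ, g1 adj z X) * (ratio ρ * (Real.exp (-Vconst) * z₀ ρ)) := by rw [hratio ρ hρ]; ring
    _ = (∏ X ∈ ρ, g1 adj z X) * (ratio ρ * Real.exp (-PL - ∑ X ∈ 𝒳, (W6p ρ X + W6pp ρ X))) := by rw [hexp]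

end Corner

/-! ## §2 On the Gaussian measures of §5.13 -/

section Gauss

variable {α I : Type} [Fintype α] [DecidableEq α] [Fintype I] [DecidableEq I]

/-- **(5.14.5) FOR THE GAUSSIAN MEASURES OF §5.13** (gen 8's finite-dimensional model: real fields on the sites, blocks `blk`, precision `Δ`
coupling only abutting cubes, source `ℱ`, cube-local factors `f(□_i)`): the corner family `zG` is cluster-factorizing (`isClusterFactorizing_zG`),
so `eq5145_corner` applies — left side `e^{−V_const}·⟨Π_{i∈W} f(□_i)⟩_{1,W}`, (5.13.4)/(5.14.1) by name, the per-region inputs displayed.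
[cite: BalabanImbrieJaffe1988, (5.14.5) p.312] -/
theorem eq5145_corner_gauss (blk : α → I) (Δ : Matrix α α ℝ) (ℱ : α → ℝ) (f : I → (α → ℝ) → ℝ) (adj : I → I → Prop) [DecidableRel adj]
    (hΔ : ∀ x y, blk x ≠ blk y → ¬ adj (blk x) (blk y) → Δ x y = 0)
    (hf : ∀ i (φ ψ : α → ℝ), (∀ x, blk x = i → φ x = ψ x) → f i φ = f i ψ) (W B : Finset I) {Xt : Type*} (𝒳 : Finset Xt)
    (Vconst PL : ℝ) (z₀ ratio pert rem : Finset (Finset I) → ℝ) (W6p W6pp : Finset (Finset I) → Xt → ℝ)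
    (hz : ∀ ρ ∈ (outer W B).filter (IsAdmissible adj), 0 < z₀ ρ)
    (hratio : ∀ ρ ∈ (outer W B).filter (IsAdmissible adj), zG blk Δ ℱ f (lam12 W ρ) (lam12' adj W ρ) = ratio ρ * z₀ ρ)
    (hlogz : ∀ ρ ∈ (outer W B).filter (IsAdmissible adj), Real.log (z₀ ρ) = -pert ρ - rem ρ)
    (hrem : ∀ ρ ∈ (outer W B).filter (IsAdmissible adj), rem ρ = ∑ X ∈ 𝒳, W6p ρ X)
    (h311 : ∀ ρ ∈ (outer W B).filter (IsAdmissible adj), Vconst + pert ρ = PL + ∑ X ∈ 𝒳, W6pp ρ X) :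
    Real.exp (-Vconst) * expect blk Δ ℱ f W (corner ℝ W) =
      ∑ ρ ∈ (outer W B).filter (IsAdmissible adj),
        (∏ X ∈ ρ, g1 adj (zG blk Δ ℱ f) X) * (ratio ρ * Real.exp (-PL - ∑ X ∈ 𝒳, (W6p ρ X + W6pp ρ X))) :=
  eq5145_corner adj (isClusterFactorizing_zG blk Δ ℱ f adj hΔ hf) W B 𝒳 Vconst PL z₀ ratio pert rem W6p W6pp hz hratio hlogz hrem h311

end Gauss

/-! ## §3 With the p. 311 extraction fed by name (p31 g12 `BIJ88Extraction311.extraction311`) -/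

section Extraction

variable {ι : Type} [DecidableEq ι] (adj : ι → ι → Prop) [DecidableRel adj]
variable {S : Type*} {K : Type*} [AddCommGroup K] [Module ℝ K]
variable {D : Type*} [Fintype D] {P : Type*} [DecidableEq P]
variable (m : D → ℕ) (spec : (γ : D) → Fin (m γ) → S) (T : (γ : D) → ι → MultilinearMap ℝ (fun _ : Fin (m γ) => K) ℝ)
variable (Cstd : S → K) (pc : Finset ι → S → Finset P) (E : Finset ι → S → P → K) (reg : P → Finset ι) (ord : D → ℕ) (nbar : ℕ)

/-- **(5.14.5), admissible bookkeeping, WITH `h311` BY NAME**: `𝒫^L := PL`, `W₆″ := W6pp` of p31's extraction recipe (region-dependent propagator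
pieces `pc Λ₁₂`, `E Λ₁₂` inside `A = Λ̄₈ ⊇ W`), `𝒳 := A.powerset`; the other per-region inputs displayed. [cite: BalabanImbrieJaffe1988, (5.14.5) p.312] -/
theorem eq5145_corner_extraction {z : Finset ι → Finset ι → ℝ} (hzc : IsClusterFactorizing adj z) (W B : Finset ι)
    (Vconst : ℝ) (A : Finset ι) (hWA : W ⊆ A) (hreg : ∀ W' s, ∀ r ∈ pc W' s, reg r ⊆ A)
    (z₀ ratio rem : Finset (Finset ι) → ℝ) (W6p : Finset (Finset ι) → Finset ι → ℝ)
    (hz : ∀ ρ ∈ (outer W B).filter (IsAdmissible adj), 0 < z₀ ρ)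
    (hratio : ∀ ρ ∈ (outer W B).filter (IsAdmissible adj), z (lam12 W ρ) (lam12' adj W ρ) = ratio ρ * z₀ ρ)
    (hlogz : ∀ ρ ∈ (outer W B).filter (IsAdmissible adj),
      Real.log (z₀ ρ) = -pert m spec T Cstd (pc (lam12 W ρ)) (E (lam12 W ρ)) (lam12 W ρ) - rem ρ)
    (hrem : ∀ ρ ∈ (outer W B).filter (IsAdmissible adj), rem ρ = ∑ X ∈ A.powerset, W6p ρ X) :
    Real.exp (-Vconst) * z W W =
      ∑ ρ ∈ (outer W B).filter (IsAdmissible adj), (∏ X ∈ ρ, g1 adj z X) * (ratio ρ *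
        Real.exp (-PL m spec T Cstd ord nbar Vconst A - ∑ X ∈ A.powerset, (W6p ρ X
          + W6pp m spec T Cstd (pc (lam12 W ρ)) (E (lam12 W ρ)) reg ord nbar A (lam12 W ρ) X))) :=
  eq5145_corner adj hzc W B A.powerset Vconst (PL m spec T Cstd ord nbar Vconst A) z₀ ratio
    (fun ρ => pert m spec T Cstd (pc (lam12 W ρ)) (E (lam12 W ρ)) (lam12 W ρ)) rem W6p
    (fun ρ X => W6pp m spec T Cstd (pc (lam12 W ρ)) (E (lam12 W ρ)) reg ord nbar A (lam12 W ρ) X) hz hratio hlogz hrem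
    fun ρ _ => extraction311 m spec T Cstd (pc (lam12 W ρ)) (E (lam12 W ρ)) reg ord nbar Vconst ((lam12_subset W ρ).trans hWA) (hreg _)

variable {α : Type} [Fintype α] [DecidableEq α] [Fintype ι]

/-- **… AND ON THE GAUSSIAN MEASURES OF §5.13**: (5.13.4)/(5.14.1) by name (`isClusterFactorizing_zG`, `polymerRep_resummed`) and p. 311 by name
(`extraction311`); displayed per region: the normalization `z₀ > 0`, *"z_F = (z_F/z)·z"* with `ratio = ⟨Π F⟩₁`, the (5.14.2) split for p31's `pert`,
and `ℛ_k = Σ W₆′`. [cite: BalabanImbrieJaffe1988, (5.14.5) p.312] -/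
theorem eq5145_corner_gauss_extraction (blk : α → ι) (Δ : Matrix α α ℝ) (ℱ : α → ℝ) (f : ι → (α → ℝ) → ℝ)
    (hΔ : ∀ x y, blk x ≠ blk y → ¬ adj (blk x) (blk y) → Δ x y = 0)
    (hf : ∀ i (φ ψ : α → ℝ), (∀ x, blk x = i → φ x = ψ x) → f i φ = f i ψ) (W B : Finset ι)
    (Vconst : ℝ) (A : Finset ι) (hWA : W ⊆ A) (hreg : ∀ W' s, ∀ r ∈ pc W' s, reg r ⊆ A)
    (z₀ ratio rem : Finset (Finset ι) → ℝ) (W6p : Finset (Finset ι) → Finset ι → ℝ)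
    (hz : ∀ ρ ∈ (outer W B).filter (IsAdmissible adj), 0 < z₀ ρ)
    (hratio : ∀ ρ ∈ (outer W B).filter (IsAdmissible adj), zG blk Δ ℱ f (lam12 W ρ) (lam12' adj W ρ) = ratio ρ * z₀ ρ)
    (hlogz : ∀ ρ ∈ (outer W B).filter (IsAdmissible adj),
      Real.log (z₀ ρ) = -pert m spec T Cstd (pc (lam12 W ρ)) (E (lam12 W ρ)) (lam12 W ρ) - rem ρ)
    (hrem : ∀ ρ ∈ (outer W B).filter (IsAdmissible adj), rem ρ = ∑ X ∈ A.powerset, W6p ρ X) :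
    Real.exp (-Vconst) * expect blk Δ ℱ f W (corner ℝ W) =
      ∑ ρ ∈ (outer W B).filter (IsAdmissible adj), (∏ X ∈ ρ, g1 adj (zG blk Δ ℱ f) X) * (ratio ρ *
        Real.exp (-PL m spec T Cstd ord nbar Vconst A - ∑ X ∈ A.powerset, (W6p ρ X
          + W6pp m spec T Cstd (pc (lam12 W ρ)) (E (lam12 W ρ)) reg ord nbar A (lam12 W ρ) X))) :=
  eq5145_corner_extraction adj m spec T Cstd pc E reg ord nbar (isClusterFactorizing_zG blk Δ ℱ f adj hΔ hf) W B Vconst A hWA hreg z₀ ratio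
    rem W6p hz hratio hlogz hrem

end Extraction

end Literature.MathematicalPhysics.QuantumFieldTheory.BalabanImbrieJaffe1984to88.BIJ88Eq5145Corner

end
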